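import Mathlib
import HarnessLib

/-!
# OSW self-similar mechanism — log-concavity on Chen's arc (MECHANISM.md v29/v29d §34.10–34.12) — part 01 of 01

1-D model (gCLM/OSW), computer-assisted; not Euler/NS.  Filed under `Summits/NavierStokesRegularity/OSWSelfSimilar/` by a prover-role courier on behalf of the
mechanism seat pub-oswblow-mech (planner-pub-oswblow-mech-g29-0), cell pub-oswblow (host summit NavierStokesRegularity); the gate admits the path but
not role planner.  CONTENT = the staged transcript `pub-oswblow-mech/lean/OSWMechanismLogConcave.lean` (sha256 82e4b7ea45be1a3b…,
293 lines), source lines 32–293, UNCHANGED except: (i) namespace prefix `OSWSelfSimilar.Mechanism` → `Summit.NavierStokesRegularity.OSWSelfSimilar.Mechanism`;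
(ii) [parts >= 02 only: the frames open at the cut are re-opened above the body and closed at the end; nothing to re-open here]
(iii) this docstring and, below it, the transcript's own module documentation VERBATIM (renamed).  Generated by `pub-oswblow-mech/lean/courier/make_split.py`; the parts must be filed IN ORDER
(each imports its predecessor).  First/last declarations here: `psi2_elementary_part_eq_one` … `PsiSecondDerivStrictMono` (28 in this part).
AI-written transcript; kernel-checked on the farm as ONE file before splitting (see the kit's CHECKS); to be checked, not trusted.
-/

/-!
# OSW self-similar mechanism — log-concavity on Chen's arc (MECHANISM.md v29/v29d, §34.10–34.12: LEMMA 34.8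
(incl. (iii), v29d), LEMMA 34.9, THEOREM 34.10 = THEOREM M40) — the Mathlib-only, kernel-checked part, and the
typed statements.

1-D model (gCLM/OSW), computer-assisted; not Euler/NS.

gen 29, planner-pub-oswblow-mech-g29-0, 2026-08-20 (rev. v29d, same day); v1.1 track.  AI-written; to be checked,
not trusted.

Contents.  (224) the elementary identity behind (34.7), `ψ″ = 1 + 2(sin x·log(2cos(x/2)) − cos x·Cl₂(π−x))/sin³x`:
the three non-Clausen terms of `ψ″` sum to `1` exactly (`psi2_elementary_part_eq_one`);  (225) `log 2 > ¼`
(`log_two_gt_quarter`, i.e. `B₀′(0) > 0`) and `B₀″ < 0` termwise (`tan_half_pos`, `B0_second_neg`);  the two-sided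
Jordan bound `(2/π)·min(x, π−x) ≤ sin x` on `[0,π]` used in LEMMA 34.3/34.9 (`two_div_pi_mul_min_le_sin`);  the
quotient bound (α) of the proof of THEOREM M40, `|(D/sin x)′| ≤ (π/2 + π²/8)η` on `(0,1]` from `|D′| ≤ ηx`,
`|D| ≤ ηx²/2`, `sin x ≥ (2/π)x` (`quotient_deriv_bound`);  the sink/bulk inequality (34.14) (`sink_bulk_bound`);
the source inequality (34.15) (`source_bound`);  and the assembly of the two regions (`logconcave_of_regions`).
v29d (REMARK 34.8(3), LEMMA 34.8(iii)): the algebra of the monotonicity criterion for `ψ″` — `E = s·D₀′ − 3c·D₀`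
expanded (`E_criterion_identity`), its sink-variable form (`one_add_two_cos_sq`, `E_theta_form`, the half-angle
identity `half_angle_tan_identity`), and the signs of the exact source-germ coefficients `κ₅ = (4/15)log 2 − 11/120 > 0`,
`κ₇ = 43/5040 − (16/315)log 2 < 0` and `1 < ψ″(0⁺) = 5/6 + (2/3)log 2 < 13/10` (`kappa5_pos`, `kappa7_neg`,
`psi2_at_zero_bounds`).
TYPED, NOT PROVED HERE (docstrings say so; no axiom, no `sorry`): the Clausen function `cl2`, the shape function
`psiDG` of (23.8), LEMMA 34.8(ii) (`PsiConvexIneq`), THEOREM M40 over an abstract profile family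
(`StrictLogConcaveOnArc`, `M40Statement`) — the analytic family of THEOREM M28 is not formalised —, and (v29d)
LEMMA 34.8(iii): the function `Efun` of REMARK 34.8(3), `EPositive` (`E > 0` on `(0,π)`, PROVED computer-assisted by
the exact-rational certificate `compute/v29/psi2mono/e_certify.py`, not kernel-checked) and `PsiSecondDerivStrictMono`.
-/

noncomputable section

open Set Real

namespace Summit.NavierStokesRegularity.OSWSelfSimilar.Mechanism.LogConcaveArc

/-! ### (224) The elementary part of `ψ″` -/

/-- (224), LEMMA 34.8(i): with `u = cos(x/2) ≠ 0` and `sin(x/2) ≠ 0` (i.e. `0 < x < π` up to periodicity),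
`½ + ¼sec²(x/2) + ½·cot x·tan(x/2) = 1`.  Ingredients: `cos x = 2cos²(x/2) − 1`, `sin x = 2 sin(x/2) cos(x/2)`. -/
theorem psi2_elementary_part_eq_one (x : ℝ) (hc : Real.cos (x / 2) ≠ 0) (hs : Real.sin (x / 2) ≠ 0) :
    1 / 2 + 1 / (4 * Real.cos (x / 2) ^ 2)
      + 1 / 2 * (Real.cos x / Real.sin x) * Real.tan (x / 2) = 1 := by
  have hx : x = 2 * (x / 2) := by ring
  have hcos : Real.cos x = 2 * Real.cos (x / 2) ^ 2 - 1 := by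
    conv_lhs => rw [hx]
    rw [Real.cos_two_mul]
  have hsin : Real.sin x = 2 * Real.sin (x / 2) * Real.cos (x / 2) := by
    conv_lhs => rw [hx]
    rw [Real.sin_two_mul]
  rw [Real.tan_eq_sin_div_cos, hcos, hsin]
  field_simp
  ring

/-! ### (225) `B₀′(0) = log 2 − ¼ > 0` and `B₀″ < 0` -/

/-- `log 2 > ¼` (so `B₀′(0) = log 2 − ¼ > 0`). -/
theorem log_two_gt_quarter : (1 : ℝ) / 4 < Real.log 2 := by
  have h := Real.log_two_gt_d9
  linarith

/-- On `(0,π)`, `tan(x/2) > 0`. -/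
theorem tan_half_pos (x : ℝ) (h0 : 0 < x) (h1 : x < Real.pi) : 0 < Real.tan (x / 2) := by
  apply Real.tan_pos_of_pos_of_lt_pi_div_two <;> linarith

/-- (225): `B₀″ = −½tan(x/2) − ¼sec²(x/2)·tan(x/2) < 0` whenever `tan(x/2) > 0` and `cos(x/2) ≠ 0`. -/
theorem B0_second_neg (x : ℝ) (ht : 0 < Real.tan (x / 2)) (hc : Real.cos (x / 2) ≠ 0) :
    -(1 / 2) * Real.tan (x / 2) - 1 / 4 * (1 / Real.cos (x / 2) ^ 2) * Real.tan (x / 2) < 0 := by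
  have hsec : 0 < 1 / Real.cos (x / 2) ^ 2 := by positivity
  nlinarith [mul_pos hsec ht]

/-! ### Jordan, two-sided: `(2/π)·min(x, π − x) ≤ sin x` on `[0,π]` -/

/-- `(2/π)·min(x, π−x) ≤ sin x` for `0 ≤ x ≤ π` (Jordan's inequality on `[0,π/2]`, and `sin x = sin(π−x)`). -/
theorem two_div_pi_mul_min_le_sin (x : ℝ) (h0 : 0 ≤ x) (h1 : x ≤ Real.pi) :
    2 / Real.pi * min x (Real.pi - x) ≤ Real.sin x := by
  have hpi : 0 < Real.pi := Real.pi_pos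
  rcases le_or_gt x (Real.pi / 2) with h | h
  · have hm : min x (Real.pi - x) = x := min_eq_left (by linarith)
    rw [hm]
    exact Real.mul_le_sin h0 h
  · have hm : min x (Real.pi - x) = Real.pi - x := min_eq_right (by linarith)
    rw [hm, ← Real.sin_pi_sub]
    exact Real.mul_le_sin (by linarith) (by linarith)

/-! ### (α) of the proof of THEOREM M40: the quotient bound on `(0,1]` -/

/-- If `|D′| ≤ ηx`, `|D| ≤ ηx²/2`, `sin x ≥ (2/π)x > 0` and `|cos x| ≤ 1`, then
`|D′/s − D·c/s²| ≤ (π/2 + π²/8)·η` (here `s = sin x`, `c = cos x`, `0 < x ≤ 1`). -/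
theorem quotient_deriv_bound (x s c D D' η : ℝ) (hx0 : 0 < x) (hs : 2 / Real.pi * x ≤ s)
    (hc : |c| ≤ 1) (hD' : |D'| ≤ η * x) (hD : |D| ≤ η * x ^ 2 / 2) (hη : 0 ≤ η) :
    |D' / s - D * c / s ^ 2| ≤ (Real.pi / 2 + Real.pi ^ 2 / 8) * η := by
  have hpi : 0 < Real.pi := Real.pi_pos
  have hpi3 : Real.pi ≤ 4 := Real.pi_le_four
  have hxs : 0 < 2 / Real.pi * x := by positivity
  have hs0 : 0 < s := lt_of_lt_of_le hxs hs
  -- first term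
  have h1 : |D' / s| ≤ Real.pi / 2 * η := by
    rw [abs_div, abs_of_pos hs0, div_le_iff₀ hs0]
    have : η * x ≤ Real.pi / 2 * η * s := by
      have h2 : η * x = Real.pi / 2 * η * (2 / Real.pi * x) := by field_simp
      rw [h2]
      have : 0 ≤ Real.pi / 2 * η := by positivity
      exact mul_le_mul_of_nonneg_left hs this
    linarith
  -- second term
  have h2 : |D * c / s ^ 2| ≤ Real.pi ^ 2 / 8 * η := by
    have hs2 : 0 < s ^ 2 := by positivity
    rw [abs_div, abs_of_pos hs2, div_le_iff₀ hs2, abs_mul]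
    have hDc : |D| * |c| ≤ η * x ^ 2 / 2 := by
      calc |D| * |c| ≤ |D| * 1 := by exact mul_le_mul_of_nonneg_left hc (abs_nonneg D)
        _ = |D| := by ring
        _ ≤ η * x ^ 2 / 2 := hD
    have hss : (2 / Real.pi * x) ^ 2 ≤ s ^ 2 := by
      exact pow_le_pow_left₀ hxs.le hs 2
    have hss' : 4 / Real.pi ^ 2 * x ^ 2 ≤ s ^ 2 := by
      have : (2 / Real.pi * x) ^ 2 = 4 / Real.pi ^ 2 * x ^ 2 := by field_simp; ring
      linarith [this ▸ hss]
    have : η * x ^ 2 / 2 ≤ Real.pi ^ 2 / 8 * η * s ^ 2 := by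
      have h3 : η * x ^ 2 / 2 = Real.pi ^ 2 / 8 * η * (4 / Real.pi ^ 2 * x ^ 2) := by field_simp; ring
      rw [h3]
      have : 0 ≤ Real.pi ^ 2 / 8 * η := by positivity
      exact mul_le_mul_of_nonneg_left hss' this
    linarith
  calc |D' / s - D * c / s ^ 2| ≤ |D' / s| + |D * c / s ^ 2| := abs_sub _ _
    _ ≤ Real.pi / 2 * η + Real.pi ^ 2 / 8 * η := add_le_add h1 h2
    _ = (Real.pi / 2 + Real.pi ^ 2 / 8) * η := by ring

/-! ### (34.14): the sink/bulk region -/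

/-- (34.14): if `m > 0`, `Q⁰ ≤ −m`, `|Q − Q⁰| ≤ C₅ε ≤ m/2`, `0 < g̃ ≤ (3/2)s`, `0 < s ≤ 1`, then
`(ε/a)·Q/g̃² ≤ −(2m/9)·(ε/a)` (`ε, a > 0`). -/
theorem sink_bulk_bound (ε a m C5 Q Q0 g s : ℝ) (hε : 0 < ε) (ha : 0 < a) (hm : 0 < m)
    (hQ0 : Q0 ≤ -m) (hQQ : |Q - Q0| ≤ C5 * ε) (hsmall : C5 * ε ≤ m / 2)
    (hg0 : 0 < g) (hgs : g ≤ 3 / 2 * s) (hs1 : s ≤ 1) :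
    ε / a * (Q / g ^ 2) ≤ -(2 * m / 9) * (ε / a) := by
  have hQ : Q ≤ -(m / 2) := by
    have := (abs_le.mp (le_trans hQQ hsmall)).2
    linarith
  have hg2 : g ^ 2 ≤ 9 / 4 := by nlinarith
  have hg2pos : 0 < g ^ 2 := by positivity
  have hεa : 0 < ε / a := by positivity
  -- Q/g² ≤ (4/9) Q since Q < 0 and g² ≤ 9/4
  have hq : Q / g ^ 2 ≤ -(2 * m / 9) := by
    rw [div_le_iff₀ hg2pos]
    have h29 : 2 * m / 9 * g ^ 2 ≤ 2 * m / 9 * (9 / 4) :=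
      mul_le_mul_of_nonneg_left hg2 (by positivity)
    nlinarith
  calc ε / a * (Q / g ^ 2) ≤ ε / a * (-(2 * m / 9)) := by exact mul_le_mul_of_nonneg_left hq hεa.le
    _ = -(2 * m / 9) * (ε / a) := by ring

/-! ### (34.15): the source region -/

/-- (34.15): with `A = (χ_ε/s)′ ≤ −½`, `ρ ∈ [2/3, 2]` (only `ρ ≥ 2/3` is used), `|B| ≤ P + 1` (`B = χ_ε/s`,
`P = ψ′(1) ≥ 0`), `|ρ′| ≤ R` with `R·(P+1) ≤ 1/12`, one gets `(χ_ε/g̃_ε)′ = Aρ + Bρ′ ≤ −¼`. -/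
theorem source_bound (A ρ B ρ' P R : ℝ) (hA : A ≤ -(1 / 2)) (hρ : 2 / 3 ≤ ρ) (hP : 0 ≤ P)
    (hB : |B| ≤ P + 1) (hρ' : |ρ'| ≤ R) (hR : R * (P + 1) ≤ 1 / 12) :
    A * ρ + B * ρ' ≤ -(1 / 4) := by
  have h1 : A * ρ ≤ -(1 / 3) := by nlinarith
  have h2 : B * ρ' ≤ 1 / 12 := by
    have hBr : B * ρ' ≤ |B| * |ρ'| := by
      rw [← abs_mul]; exact le_abs_self _
    have : |B| * |ρ'| ≤ (P + 1) * R :=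
      mul_le_mul hB hρ' (abs_nonneg _) (by linarith)
    nlinarith
  linarith

/-- (34.15), last step: `(log u_ε)″ = (ε/a)·(χ_ε/g̃_ε)′ ≤ −ε/(4a)` from `(χ_ε/g̃_ε)′ ≤ −¼`. -/
theorem source_logconcave (ε a T : ℝ) (hε : 0 < ε) (ha : 0 < a) (hT : T ≤ -(1 / 4)) :
    ε / a * T ≤ -(ε / (4 * a)) := by
  have hεa : 0 < ε / a := by positivity
  calc ε / a * T ≤ ε / a * (-(1 / 4)) := mul_le_mul_of_nonneg_left hT hεa.le
    _ = -(ε / (4 * a)) := by ring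

/-! ### Assembly of the two regions -/

/-- THEOREM M40, assembly: negativity on `(0,1]` and on `[1,π)` gives negativity on `(0,π)`. -/
theorem logconcave_of_regions (L : ℝ → ℝ) (h1 : ∀ x, 0 < x → x ≤ 1 → L x < 0)
    (h2 : ∀ x, 1 ≤ x → x < Real.pi → L x < 0) : ∀ x, 0 < x → x < Real.pi → L x < 0 := by
  intro x hx0 hxπ
  rcases le_or_gt x 1 with h | h
  · exact h1 x hx0 h
  · exact h2 x h.le hxπ

/-! ### (v29d) REMARK 34.8(3) / LEMMA 34.8(iii): the algebra of the monotonicity criterion and the germ signs -/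

/-- REMARK 34.8(3): with `D₀ = sL − cC` and `D₀′ = s(C − t/2)` (`t = tan(x/2)`; the `cL` terms cancel because `C′ = L`),
`E := s·D₀′ − 3c·D₀ = (s² + 3c²)C − 3scL − (s²/2)t`.  Pure algebra. -/
theorem E_criterion_identity (s c C L t : ℝ) :
    s * (s * (C - t / 2)) - 3 * c * (s * L - c * C)
      = (s ^ 2 + 3 * c ^ 2) * C - 3 * s * c * L - s ^ 2 / 2 * t := by
  ring

/-- `D₀′ = cL − (s/2)t + sC − cL = s(C − t/2)`: the cancellation used in REMARK 34.8(3). -/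
theorem D0_deriv_cancel (s c C L t : ℝ) :
    c * L - s / 2 * t + s * C - c * L = s * (C - t / 2) := by
  ring

/-- `1 + 2cos²θ = sin²θ + 3cos²θ`. -/
theorem one_add_two_cos_sq (θ : ℝ) :
    1 + 2 * Real.cos θ ^ 2 = Real.sin θ ^ 2 + 3 * Real.cos θ ^ 2 := by
  nlinarith [Real.sin_sq_add_cos_sq θ]

/-- Passing to the sink variable `θ = π − x` (`sin x = sin θ =: s`, `cos x = −cos θ`, here `c` stands for `cos θ`):
`(s² + 3(−c)²)C − 3s(−c)L − (s²/2)t = (s² + 3c²)C + 3scL − (s²/2)t`. -/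
theorem E_theta_form (s c C L t : ℝ) :
    (s ^ 2 + 3 * (-c) ^ 2) * C - 3 * s * (-c) * L - s ^ 2 / 2 * t
      = (s ^ 2 + 3 * c ^ 2) * C + 3 * s * c * L - s ^ 2 / 2 * t := by
  ring

/-- The half-angle identity `(sin²θ/2)·cot(θ/2) = ½ sin θ(1 + cos θ)` in the variables `sh = sin(θ/2) ≠ 0`,
`ch = cos(θ/2)`: `sin θ = 2·sh·ch`, `1 + cos θ = 2ch²`, `tan(x/2) = cot(θ/2) = ch/sh`. -/
theorem half_angle_tan_identity (sh ch : ℝ) (hsh : sh ≠ 0) :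
    (2 * sh * ch) ^ 2 / 2 * (ch / sh) = 1 / 2 * (2 * sh * ch) * (2 * ch ^ 2) := by
  field_simp

/-- The exact source-germ coefficient of `E` (REMARK 34.8(3)(a)): `κ₅ = (4/15)log 2 − 11/120 > 0`. -/
theorem kappa5_pos : 0 < 4 / 15 * Real.log 2 - 11 / 120 := by
  have h := Real.log_two_gt_d9
  linarith

/-- The next coefficient: `κ₇ = 43/5040 − (16/315)log 2 < 0`. -/
theorem kappa7_neg : 43 / 5040 - 16 / 315 * Real.log 2 < 0 := by
  have h := Real.log_two_gt_d9
  linarith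

/-- `ψ″(0⁺) = 5/6 + (2/3)log 2` lies in `(1, 13/10)` (it is `1.295431…`; LEMMA 34.8(ii)/(iii)). -/
theorem psi2_at_zero_bounds :
    1 < 5 / 6 + 2 / 3 * Real.log 2 ∧ 5 / 6 + 2 / 3 * Real.log 2 < 13 / 10 := by
  have h1 := Real.log_two_gt_d9
  have h2 := Real.log_two_lt_d9
  constructor <;> linarith

/-! ### Typed statements (proved in MECHANISM.md §34.10–34.12; NOT kernel-checked; no axiom) -/

/-- The Clausen function `Cl₂(θ) = Σ_{k≥1} sin(kθ)/k²`. -/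
def cl2 (θ : ℝ) : ℝ := ∑' k : ℕ, Real.sin (((k : ℝ) + 1) * θ) / (((k : ℝ) + 1) ^ 2)

/-- The De Gregorio-end shape function `ψ = φ⁰/sin x` of (23.8):
`ψ(x) = ½ + x²/4 − log(2cos(x/2)) − cot x·Cl₂(π − x)`. -/
def psiDG (x : ℝ) : ℝ :=
  1 / 2 + x ^ 2 / 4 - Real.log (2 * Real.cos (x / 2)) - Real.cos x / Real.sin x * cl2 (Real.pi - x)

/-- LEMMA 34.8(ii) (PROVED in MECHANISM.md §34.10, pen-and-paper; not kernel-checked — `Cl₂` has no Mathlib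
theory): `cos x·Cl₂(π−x) < sin x·log(2cos(x/2))` on `(0,π)`, equivalently `ψ″ > 1` by (34.7). -/
def PsiConvexIneq : Prop :=
  ∀ x : ℝ, 0 < x → x < Real.pi →
    Real.cos x * cl2 (Real.pi - x) < Real.sin x * Real.log (2 * Real.cos (x / 2))

/-- LEMMA 34.8(i), the formula (34.7) (PROVED in MECHANISM.md §34.10 by differentiating (23.8) twice; the elementary
part is `psi2_elementary_part_eq_one`; not kernel-checked as a statement about `deriv`). -/
def PsiSecondDerivFormula : Prop :=
  ∀ x : ℝ, 0 < x → x < Real.pi →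
    deriv (deriv psiDG) x
      = 1 + 2 * (Real.sin x * Real.log (2 * Real.cos (x / 2)) - Real.cos x * cl2 (Real.pi - x)) / Real.sin x ^ 3

/-- Strict log-concavity of a positive function on `(0,π)` in the `C²` sense used in §28/(34.13). -/
def StrictLogConcaveOnArc (u : ℝ → ℝ) : Prop :=
  (∀ x, 0 < x → x < Real.pi → 0 < u x) ∧
    ∀ x, 0 < x → x < Real.pi → deriv (deriv fun t => Real.log (u t)) x < 0

/-- THEOREM 34.10 = THEOREM M40 (PROVED in MECHANISM.md §34.12, pen-and-paper; not kernel-checked): for the family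
`u ε = F_ε/sin x` of blown-up profiles of THEOREM M28 at `a = 1 − ε` (Chen's arc), there is `ε_LC > 0` with
`u ε` strictly log-concave on `(0,π)` for `0 < ε ≤ ε_LC`.  Typed over an ABSTRACT family `u : ℝ → ℝ → ℝ`
(the analytic family itself is not formalised; no axiom). -/
def M40Statement (u : ℝ → ℝ → ℝ) : Prop :=
  ∃ εLC : ℝ, 0 < εLC ∧ ∀ ε : ℝ, 0 < ε → ε ≤ εLC → StrictLogConcaveOnArc (u ε)

/-- REMARK 34.8(3): the monotonicity criterion `E(θ) = (1 + 2cos²θ)·Cl₂(θ) + (3/2)·sin 2θ·log(2 sin(θ/2)) − ½·sin θ·(1 + cos θ)`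
(`(D₀/sin³x)′ = E(π − x)/sin⁴x`). -/
def Efun (θ : ℝ) : ℝ :=
  (1 + 2 * Real.cos θ ^ 2) * cl2 θ + 3 / 2 * Real.sin (2 * θ) * Real.log (2 * Real.sin (θ / 2))
    - 1 / 2 * Real.sin θ * (1 + Real.cos θ)

/-- LEMMA 34.8(iii), core inequality (PROVED in MECHANISM.md §34.10, COMPUTER-ASSISTED: exact-rational certificate
`compute/v29/psi2mono/e_certify.py` in three segments — analytic on `(0,½]`, certified enclosures on `[½, 2.6416]`,
exact polynomial plus remainder on `[π − ½, π)`; not kernel-checked; no axiom): `E > 0` on `(0,π)`. -/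
def EPositive : Prop :=
  ∀ θ : ℝ, 0 < θ → θ < Real.pi → 0 < Efun θ

/-- `ψ″` as a closed form, (34.7). -/
def psi2DG (x : ℝ) : ℝ :=
  1 + 2 * (Real.sin x * Real.log (2 * Real.cos (x / 2)) - Real.cos x * cl2 (Real.pi - x)) / Real.sin x ^ 3

/-- LEMMA 34.8(iii) (PROVED in MECHANISM.md §34.10 from `EPositive`; not kernel-checked): `ψ″` is strictly increasing
on `(0,π)`; consequently `inf ψ″ = ψ″(0⁺) = 5/6 + (2/3)log 2` (`psi2_at_zero_bounds`). -/
def PsiSecondDerivStrictMono : Prop :=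
  StrictMonoOn psi2DG (Set.Ioo 0 Real.pi)

end Summit.NavierStokesRegularity.OSWSelfSimilar.Mechanism.LogConcaveArc

end
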